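import Literature.Analysis.FluidPDE.PineauVicolWeightedIdentity
import Literature.Analysis.FluidPDE.TaoEnstrophyLocalisation
import Literature.Analysis.FluidPDE.TsaiProfileEndgame
import HarnessLib

/-!
# Crux `Target` (stmt-NavierStokesRegularity-1217), line `killing-twisted-bernoulli-solitons`:
  pointwise bounds for the ROTATION-DEFECT estimate (tool file 1 of 2 for stub B5b)

Support file (helpers only, `--supports stmt-NavierStokesRegularity-1217`). For a smooth
solution `(U, P)` of Pineau–Vicol's rotated self-similar profile system (arXiv:2607.09619,
(1.8a)) `α(JU − DU(Jy)) + ½U + ½DU(y) − ΔU + DU(U) + ∇P = 0`, `J = rotGen`, with the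
Type-I bound `|U| ≤ C₀` and bounded `DU`, `ΔU`, this file records the elementary pointwise
facts feeding the weighted identity (5.4) in the next file
(`TypeICertificateLadderTargetRotationDefect.lean`):

* `rotationDefect_errorTerm_eq` / `rotationDefect_abs_errorTerm_le`: the error term (4.4) of
  the Bernoulli identity (4.3) is `E = −⟪U + ½y, RU⟫` with the ROTATION DEFECT
  `RU = JU − DU(Jy)` (the operator `R = J − (Jy)·∇` of §1.2/§6, whose kernel is the
  axisymmetric fields), hence `|E| ≤ ‖U + ½y‖ ‖RU‖` pointwise;
* polynomial bounds: `‖U + ½y‖`, `‖RU‖`, `‖∇P‖` (solved from the system), `|P|` (mean value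
  inequality), the head pressure `Π = ½|U|² + P + ½y·U` and `‖∇Π‖` grow at most
  quadratically, `|curl U|²` is bounded (`rotationDefect_norm_drift_le`, `…_norm_defect_le`,
  `…_norm_gradient_pressure_le`, `…_abs_pressure_le`, `…_abs_head_le`, `…_norm_gradient_head_le`,
  `…_abs_errorTerm_le_sq`, `…_norm_curl_sq_le`);
* `rotationDefect_integrable_of_le_poly_gauss`: polynomial × Gaussian domination gives
  integrability on `ℝ³` (from the tree's `integrable_one_add_norm_pow_mul_exp_neg_mul_sq`).

## References

* B. Pineau, V. Vicol, arXiv:2607.09619 (2026): (1.8a) p. 3, §1.2 p. 5 (the operator `R`),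
  §4 (4.1)–(4.4) p. 11, Lemma 2.1 (2.1)–(2.2) p. 9. [PineauVicol2026]
-/

noncomputable section

namespace Summit.NavierStokesRegularity.NavierStokesRegularity.Theorems

open MeasureTheory Set Function Filter Topology InnerProductSpace Real Metric
open scoped RealInnerProductSpace Laplacian ContDiff BigOperators ENNReal NNReal
open Literature.Analysis.FluidPDE Literature.Analysis.FluidPDE.PineauVicol2026

/-! ### The error term as a rotation-defect pairing -/

/-- **The error term is a rotation-defect pairing.** For every field `U` on `ℝ³` and every `y`,
`½⟪Jy, U⟫ + ⟪U + ½y, DU(Jy)⟫ = −⟪U + ½y, JU − DU(Jy)⟫` (`J = rotGen`): Pineau–Vicol's error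
term (4.4) equals `−(U + ½y)·RU` with the rotation operator `RU = JU − (Jy·∇)U` of §1.2/§6
(the middle expression of (4.3), p. 11), by the skewness of `J` (`⟪JU, U⟫ = 0`,
`⟪y, JU⟫ = −⟪Jy, U⟫`). [cite: PineauVicol2026, (4.3)–(4.4) (p. 11)] -/
theorem rotationDefect_errorTerm_eq
    (U : EuclideanSpace ℝ (Fin 3) → EuclideanSpace ℝ (Fin 3)) (y : EuclideanSpace ℝ (Fin 3)) :
    (1 / 2 : ℝ) * ⟪rotGen y, U y⟫ + ⟪U y + (1 / 2 : ℝ) • y, fderiv ℝ U y (rotGen y)⟫ =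
      -⟪U y + (1 / 2 : ℝ) • y, rotGen (U y) - fderiv ℝ U y (rotGen y)⟫ := by
  have h1 : ⟪U y, rotGen (U y)⟫ = 0 := by rw [real_inner_comm]; exact inner_rotGen_self _
  have h2 : ⟪y, rotGen (U y)⟫ = -⟪rotGen y, U y⟫ := by
    rw [real_inner_comm, inner_rotGen_left, inner_rotGen_left]; ring
  rw [inner_sub_right, inner_add_left (U y) ((1 / 2 : ℝ) • y) (rotGen (U y)),
    real_inner_smul_left, h1, h2]
  ring

/-- **Pointwise bound of the error term by the rotation defect**:
`|½⟪Jy, U⟫ + ⟪U + ½y, DU(Jy)⟫| ≤ ‖U + ½y‖ · ‖JU − DU(Jy)‖` (Cauchy–Schwarz in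
`rotationDefect_errorTerm_eq`). [cite: PineauVicol2026, (4.3)–(4.4) (p. 11)] -/
theorem rotationDefect_abs_errorTerm_le
    (U : EuclideanSpace ℝ (Fin 3) → EuclideanSpace ℝ (Fin 3)) (y : EuclideanSpace ℝ (Fin 3)) :
    |(1 / 2 : ℝ) * ⟪rotGen y, U y⟫ + ⟪U y + (1 / 2 : ℝ) • y, fderiv ℝ U y (rotGen y)⟫| ≤
      ‖U y + (1 / 2 : ℝ) • y‖ * ‖rotGen (U y) - fderiv ℝ U y (rotGen y)‖ := by
  rw [rotationDefect_errorTerm_eq, abs_neg]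
  exact abs_real_inner_le_norm _ _

/-! ### Polynomial × Gaussian integrability on `ℝ³` -/

/-- Domination by `C (1 + |y|)ᴺ e^{−c|y|²}`, `c > 0`, of an a.e.-strongly measurable function on
`ℝ³` gives integrability (from the tree's `integrable_one_add_norm_pow_mul_exp_neg_mul_sq`). [folklore] -/
theorem rotationDefect_integrable_of_le_poly_gauss {F : Type*} [NormedAddCommGroup F]
    {f : EuclideanSpace ℝ (Fin 3) → F} (hf : AEStronglyMeasurable f volume) {C c : ℝ} {N : ℕ}
    (hc : 0 < c) (h : ∀ y, ‖f y‖ ≤ C * ((1 + ‖y‖) ^ N * Real.exp (-c * ‖y‖ ^ 2))) :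
    Integrable f := by
  have hg := (integrable_one_add_norm_pow_mul_exp_neg_mul_sq
    (E := EuclideanSpace ℝ (Fin 3)) hc N).const_mul C
  exact hg.mono' hf (Eventually.of_forall h)

/-- A power of `1 + |y|` is at least `1`. [folklore] -/
theorem rotationDefect_one_le_pow (y : EuclideanSpace ℝ (Fin 3)) (N : ℕ) :
    (1 : ℝ) ≤ (1 + ‖y‖) ^ N :=
  one_le_pow₀ (by linarith [norm_nonneg y])

/-- Monotonicity of the powers of `1 + |y|` in the exponent. [folklore] -/
theorem rotationDefect_pow_le_pow (y : EuclideanSpace ℝ (Fin 3)) {N N' : ℕ} (h : N ≤ N') :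
    (1 + ‖y‖) ^ N ≤ (1 + ‖y‖) ^ N' :=
  pow_le_pow_right₀ (by linarith [norm_nonneg y]) h

/-! ### Pointwise polynomial bounds for a Type-I profile -/

section Bounds

variable {α C₀ C₁ C₂ : ℝ}
  {U : EuclideanSpace ℝ (Fin 3) → EuclideanSpace ℝ (Fin 3)} {P : EuclideanSpace ℝ (Fin 3) → ℝ}

/-- `‖U + ½y‖ ≤ (C₀ + 1)(1 + |y|)` when `|U| ≤ C₀`. [folklore] -/
theorem rotationDefect_norm_drift_le (hC₀ : 0 ≤ C₀) (hUb : ∀ y, ‖U y‖ ≤ C₀)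
    (y : EuclideanSpace ℝ (Fin 3)) : ‖U y + (1 / 2 : ℝ) • y‖ ≤ (C₀ + 1) * (1 + ‖y‖) := by
  have h1 : ‖U y + (1 / 2 : ℝ) • y‖ ≤ ‖U y‖ + ‖(1 / 2 : ℝ) • y‖ := norm_add_le _ _
  have h2 : ‖(1 / 2 : ℝ) • y‖ = (1 / 2 : ℝ) * ‖y‖ := by
    rw [norm_smul, Real.norm_of_nonneg (by norm_num)]
  nlinarith [hUb y, norm_nonneg y, norm_nonneg (U y)]

/-- The rotation defect of a bounded field with bounded gradient grows at most linearly: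
`‖JU − DU(Jy)‖ ≤ (C₀ + C₁)(1 + |y|)` (`‖Jv‖ ≤ ‖v‖`). [cite: PineauVicol2026, §1.2 (p. 5), Lemma 2.1 (p. 9)] -/
theorem rotationDefect_norm_defect_le (hC₀ : 0 ≤ C₀) (hUb : ∀ y, ‖U y‖ ≤ C₀)
    (hC₁ : ∀ y, ‖fderiv ℝ U y‖ ≤ C₁) (y : EuclideanSpace ℝ (Fin 3)) :
    ‖rotGen (U y) - fderiv ℝ U y (rotGen y)‖ ≤ (C₀ + C₁) * (1 + ‖y‖) := by
  have hC₁0 : 0 ≤ C₁ := (norm_nonneg _).trans (hC₁ 0)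
  have h1 : ‖rotGen (U y) - fderiv ℝ U y (rotGen y)‖ ≤
      ‖rotGen (U y)‖ + ‖fderiv ℝ U y (rotGen y)‖ := norm_sub_le _ _
  have h2 : ‖rotGen (U y)‖ ≤ C₀ := (norm_rotGen_le _).trans (hUb y)
  have h3 : ‖fderiv ℝ U y (rotGen y)‖ ≤ C₁ * ‖y‖ :=
    (ContinuousLinearMap.le_opNorm _ _).trans
      (mul_le_mul (hC₁ y) (norm_rotGen_le y) (norm_nonneg _) hC₁0)
  nlinarith [norm_nonneg y]

/-- **The pressure gradient, solved from the profile system**: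
`∇P = −(α RU + ½U + ½DU(y) − ΔU + DU(U))`. [cite: PineauVicol2026, (1.8a) (p. 3)] -/
theorem rotationDefect_gradient_pressure_eq
    (heq : ∀ y, α • (rotGen (U y) - fderiv ℝ U y (rotGen y)) + (1 / 2 : ℝ) • U y +
      (1 / 2 : ℝ) • fderiv ℝ U y y - (Δ U) y + fderiv ℝ U y (U y) + gradient P y = 0)
    (y : EuclideanSpace ℝ (Fin 3)) :
    gradient P y = -(α • (rotGen (U y) - fderiv ℝ U y (rotGen y)) + (1 / 2 : ℝ) • U y +
      (1 / 2 : ℝ) • fderiv ℝ U y y - (Δ U) y + fderiv ℝ U y (U y)) := by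
  rw [← sub_eq_zero, sub_neg_eq_add, ← heq y]
  abel

/-- **Linear growth of the pressure gradient**: `‖∇P(y)‖ ≤ C_P (1 + |y|)` with
`C_P = |α|(C₀ + C₁) + C₀ + C₁ + C₂ + C₁C₀` (each term of the solved gradient bounded by the
Type-I bounds on `U`, `DU`, `ΔU`). [cite: PineauVicol2026, (1.8a) (p. 3), Lemma 2.1 (2.2) (p. 9)] -/
theorem rotationDefect_norm_gradient_pressure_le (hC₀ : 0 ≤ C₀) (hUb : ∀ y, ‖U y‖ ≤ C₀)
    (hC₁ : ∀ y, ‖fderiv ℝ U y‖ ≤ C₁) (hC₂ : ∀ y, ‖(Δ U) y‖ ≤ C₂)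
    (heq : ∀ y, α • (rotGen (U y) - fderiv ℝ U y (rotGen y)) + (1 / 2 : ℝ) • U y +
      (1 / 2 : ℝ) • fderiv ℝ U y y - (Δ U) y + fderiv ℝ U y (U y) + gradient P y = 0)
    (y : EuclideanSpace ℝ (Fin 3)) :
    ‖gradient P y‖ ≤ (|α| * (C₀ + C₁) + C₀ + C₁ + C₂ + C₁ * C₀) * (1 + ‖y‖) := by
  have hC₁0 : 0 ≤ C₁ := (norm_nonneg _).trans (hC₁ 0)
  have hC₂0 : 0 ≤ C₂ := (norm_nonneg _).trans (hC₂ 0)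
  have hy1 : (1 : ℝ) ≤ 1 + ‖y‖ := by linarith [norm_nonneg y]
  rw [rotationDefect_gradient_pressure_eq heq y, norm_neg]
  have e1 : ‖α • (rotGen (U y) - fderiv ℝ U y (rotGen y))‖ ≤ |α| * ((C₀ + C₁) * (1 + ‖y‖)) := by
    rw [norm_smul, Real.norm_eq_abs]
    exact mul_le_mul_of_nonneg_left (rotationDefect_norm_defect_le hC₀ hUb hC₁ y) (abs_nonneg _)
  have e2 : ‖(1 / 2 : ℝ) • U y‖ ≤ C₀ := by
    rw [norm_smul, Real.norm_of_nonneg (by norm_num)]; nlinarith [hUb y, norm_nonneg (U y)]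
  have e3 : ‖(1 / 2 : ℝ) • fderiv ℝ U y y‖ ≤ C₁ * ‖y‖ := by
    rw [norm_smul, Real.norm_of_nonneg (by norm_num)]
    have := (ContinuousLinearMap.le_opNorm (fderiv ℝ U y) y).trans
      (mul_le_mul_of_nonneg_right (hC₁ y) (norm_nonneg y))
    nlinarith [norm_nonneg (fderiv ℝ U y y), norm_nonneg y]
  have e5 : ‖fderiv ℝ U y (U y)‖ ≤ C₁ * C₀ :=
    (ContinuousLinearMap.le_opNorm _ _).trans (mul_le_mul (hC₁ y) (hUb y) (norm_nonneg _) hC₁0)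
  have hsum : ‖α • (rotGen (U y) - fderiv ℝ U y (rotGen y)) + (1 / 2 : ℝ) • U y +
      (1 / 2 : ℝ) • fderiv ℝ U y y - (Δ U) y + fderiv ℝ U y (U y)‖ ≤
      ‖α • (rotGen (U y) - fderiv ℝ U y (rotGen y))‖ + ‖(1 / 2 : ℝ) • U y‖ +
        ‖(1 / 2 : ℝ) • fderiv ℝ U y y‖ + ‖(Δ U) y‖ + ‖fderiv ℝ U y (U y)‖ := by
    refine (norm_add_le _ _).trans (add_le_add ?_ le_rfl)
    refine (norm_sub_le _ _).trans (add_le_add ?_ le_rfl)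
    refine (norm_add_le _ _).trans (add_le_add ?_ le_rfl)
    exact norm_add_le _ _
  have k1 : C₀ ≤ C₀ * (1 + ‖y‖) := le_mul_of_one_le_right hC₀ hy1
  have k2 : C₁ * ‖y‖ ≤ C₁ * (1 + ‖y‖) := mul_le_mul_of_nonneg_left (by linarith) hC₁0
  have k3 : C₂ ≤ C₂ * (1 + ‖y‖) := le_mul_of_one_le_right hC₂0 hy1
  have k4 : C₁ * C₀ ≤ C₁ * C₀ * (1 + ‖y‖) := le_mul_of_one_le_right (mul_nonneg hC₁0 hC₀) hy1
  have eCp : (|α| * (C₀ + C₁) + C₀ + C₁ + C₂ + C₁ * C₀) * (1 + ‖y‖) =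
      |α| * ((C₀ + C₁) * (1 + ‖y‖)) + C₀ * (1 + ‖y‖) + C₁ * (1 + ‖y‖) + C₂ * (1 + ‖y‖) +
        C₁ * C₀ * (1 + ‖y‖) := by ring
  linarith [hC₂ y]

/-- **Quadratic growth of the pressure** (mean value inequality on the ball `|z| ≤ |y|`):
if `‖∇P(z)‖ ≤ C_P(1 + |z|)` everywhere then `|P(y)| ≤ (|P(0)| + C_P)(1 + |y|)²`. [folklore] -/
theorem rotationDefect_abs_pressure_le (hP : Differentiable ℝ P) {Cp : ℝ} (hCp : 0 ≤ Cp)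
    (hB : ∀ y, ‖fderiv ℝ P y‖ ≤ Cp * (1 + ‖y‖)) (y : EuclideanSpace ℝ (Fin 3)) :
    |P y| ≤ (|P 0| + Cp) * (1 + ‖y‖) ^ 2 := by
  have hmv : ‖P y - P 0‖ ≤ Cp * (1 + ‖y‖) * ‖y - 0‖ := by
    refine Convex.norm_image_sub_le_of_norm_fderiv_le
      (s := closedBall (0 : EuclideanSpace ℝ (Fin 3)) ‖y‖) (fun z _ => hP z) (fun z hz => ?_)
      (convex_closedBall _ _) (mem_closedBall_self (norm_nonneg y)) (by simp)
    have hz' : ‖z‖ ≤ ‖y‖ := by simpa using hz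
    exact (hB z).trans (mul_le_mul_of_nonneg_left (by linarith) hCp)
  rw [sub_zero, Real.norm_eq_abs] at hmv
  have h1 : |P y| ≤ |P 0| + |P y - P 0| := by
    have := abs_add_le (P 0) (P y - P 0); rwa [add_sub_cancel] at this
  have hy := norm_nonneg y
  have hsq : (1 : ℝ) ≤ (1 + ‖y‖) ^ 2 := rotationDefect_one_le_pow y 2
  have k1 : Cp * (1 + ‖y‖) * ‖y‖ ≤ Cp * (1 + ‖y‖) ^ 2 := by
    rw [sq, ← mul_assoc]
    exact mul_le_mul_of_nonneg_left (by linarith) (mul_nonneg hCp (by linarith))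
  have k2 : |P 0| ≤ |P 0| * (1 + ‖y‖) ^ 2 := le_mul_of_one_le_right (abs_nonneg _) hsq
  nlinarith

/-- **Quadratic growth of the head pressure** `Π = ½|U|² + P + ½⟪y, U⟫`:
`|Π(y)| ≤ (C₀² + A + C₀)(1 + |y|)²` if `|U| ≤ C₀` and `|P(y)| ≤ A(1+|y|)²`. [cite: PineauVicol2026, (4.1) and the display after it (p. 11)] -/
theorem rotationDefect_abs_head_le (hC₀ : 0 ≤ C₀) (hUb : ∀ y, ‖U y‖ ≤ C₀) {A : ℝ}
    (hPb : ∀ y, |P y| ≤ A * (1 + ‖y‖) ^ 2) (y : EuclideanSpace ℝ (Fin 3)) :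
    |headPressure (1 / 2) U P y| ≤ (C₀ ^ 2 + A + C₀) * (1 + ‖y‖) ^ 2 := by
  rw [headPressure_apply]
  have h1 : |2⁻¹ * ‖U y‖ ^ 2 + P y + 1 / 2 * ⟪y, U y⟫| ≤
      2⁻¹ * ‖U y‖ ^ 2 + |P y| + 1 / 2 * |⟪y, U y⟫| := by
    refine (abs_add_le _ _).trans (add_le_add ((abs_add_le _ _).trans (add_le_add ?_ le_rfl)) ?_)
    · rw [abs_of_nonneg (by positivity)]
    · rw [abs_mul, abs_of_nonneg (by norm_num : (0:ℝ) ≤ 1 / 2)]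
  have h2 : |⟪y, U y⟫| ≤ ‖y‖ * C₀ :=
    (abs_real_inner_le_norm _ _).trans (mul_le_mul_of_nonneg_left (hUb y) (norm_nonneg y))
  have h3 : ‖U y‖ ^ 2 ≤ C₀ ^ 2 := pow_le_pow_left₀ (norm_nonneg _) (hUb y) 2
  have hy := norm_nonneg y
  have hsq : (1 : ℝ) ≤ (1 + ‖y‖) ^ 2 := rotationDefect_one_le_pow y 2
  have k1 : 2⁻¹ * ‖U y‖ ^ 2 ≤ C₀ ^ 2 * (1 + ‖y‖) ^ 2 := by
    have : C₀ ^ 2 ≤ C₀ ^ 2 * (1 + ‖y‖) ^ 2 := le_mul_of_one_le_right (sq_nonneg _) hsq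
    nlinarith [sq_nonneg (‖U y‖)]
  have k2 : 1 / 2 * |⟪y, U y⟫| ≤ C₀ * (1 + ‖y‖) ^ 2 := by
    have e : ‖y‖ ≤ (1 + ‖y‖) ^ 2 := by nlinarith
    have : ‖y‖ * C₀ ≤ (1 + ‖y‖) ^ 2 * C₀ := mul_le_mul_of_nonneg_right e hC₀
    nlinarith [abs_nonneg ⟪y, U y⟫]
  have eC : (C₀ ^ 2 + A + C₀) * (1 + ‖y‖) ^ 2 =
      C₀ ^ 2 * (1 + ‖y‖) ^ 2 + A * (1 + ‖y‖) ^ 2 + C₀ * (1 + ‖y‖) ^ 2 := by ring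
  linarith [hPb y]

/-- **Linear growth of the head-pressure gradient**: with `|U| ≤ C₀`, `‖DU‖ ≤ C₁` and
`‖∇P(y)‖ ≤ C_P(1+|y|)`, `‖∇Π(y)‖ ≤ (C₀C₁ + C_P + C₀ + C₁)(1 + |y|)`
(`DΠ(y)w = ⟪U, DU w⟫ + DP w + ½(⟪w, U⟫ + ⟪y, DU w⟫)`). [cite: PineauVicol2026, (4.1) (p. 11), Lemma 2.1 (p. 9)] -/
theorem rotationDefect_norm_gradient_head_le (hU : Differentiable ℝ U) (hP : Differentiable ℝ P)
    (hC₀ : 0 ≤ C₀) (hUb : ∀ y, ‖U y‖ ≤ C₀) (hC₁ : ∀ y, ‖fderiv ℝ U y‖ ≤ C₁) {Cp : ℝ}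
    (hCp : 0 ≤ Cp) (hB : ∀ y, ‖fderiv ℝ P y‖ ≤ Cp * (1 + ‖y‖)) (y : EuclideanSpace ℝ (Fin 3)) :
    ‖gradient (headPressure (1 / 2) U P) y‖ ≤ (C₀ * C₁ + Cp + C₀ + C₁) * (1 + ‖y‖) := by
  have hC₁0 : 0 ≤ C₁ := (norm_nonneg _).trans (hC₁ 0)
  have hy1 : (1 : ℝ) ≤ 1 + ‖y‖ := by linarith [norm_nonneg y]
  have hng : ‖gradient (headPressure (1 / 2) U P) y‖ = ‖fderiv ℝ (headPressure (1 / 2) U P) y‖ := by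
    simp [gradient]
  rw [hng]
  refine ContinuousLinearMap.opNorm_le_bound _ (by positivity) fun e => ?_
  rw [fderiv_headPressure_apply hU hP y e]
  have hDUe : ‖fderiv ℝ U y e‖ ≤ C₁ * ‖e‖ :=
    (ContinuousLinearMap.le_opNorm _ _).trans (mul_le_mul_of_nonneg_right (hC₁ y) (norm_nonneg e))
  have e1 : |⟪U y, fderiv ℝ U y e⟫| ≤ C₀ * (C₁ * ‖e‖) :=
    (abs_real_inner_le_norm _ _).trans (mul_le_mul (hUb y) hDUe (norm_nonneg _) hC₀)
  have e2 : |fderiv ℝ P y e| ≤ Cp * (1 + ‖y‖) * ‖e‖ := by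
    rw [← Real.norm_eq_abs]
    exact (ContinuousLinearMap.le_opNorm _ _).trans (mul_le_mul_of_nonneg_right (hB y) (norm_nonneg e))
  have e3 : |⟪e, U y⟫| ≤ ‖e‖ * C₀ :=
    (abs_real_inner_le_norm _ _).trans (mul_le_mul_of_nonneg_left (hUb y) (norm_nonneg e))
  have e4 : |⟪y, fderiv ℝ U y e⟫| ≤ ‖y‖ * (C₁ * ‖e‖) :=
    (abs_real_inner_le_norm _ _).trans (mul_le_mul_of_nonneg_left hDUe (norm_nonneg y))
  rw [Real.norm_eq_abs]
  have hsum : |⟪U y, fderiv ℝ U y e⟫ + fderiv ℝ P y e + 1 / 2 * (⟪e, U y⟫ + ⟪y, fderiv ℝ U y e⟫)| ≤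
      |⟪U y, fderiv ℝ U y e⟫| + |fderiv ℝ P y e| + 1 / 2 * (|⟪e, U y⟫| + |⟪y, fderiv ℝ U y e⟫|) := by
    refine (abs_add_le _ _).trans (add_le_add (abs_add_le _ _) ?_)
    rw [abs_mul, abs_of_nonneg (by norm_num : (0:ℝ) ≤ 1 / 2)]
    exact mul_le_mul_of_nonneg_left (abs_add_le _ _) (by norm_num)
  have he := norm_nonneg e
  have hy := norm_nonneg y
  have k1 : C₀ * (C₁ * ‖e‖) ≤ C₀ * C₁ * (1 + ‖y‖) * ‖e‖ := by
    have : C₀ * C₁ * ‖e‖ ≤ C₀ * C₁ * ‖e‖ * (1 + ‖y‖) :=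
      le_mul_of_one_le_right (by positivity) hy1
    nlinarith
  have k2 : ‖e‖ * C₀ ≤ C₀ * (1 + ‖y‖) * ‖e‖ := by
    have : C₀ * ‖e‖ ≤ C₀ * ‖e‖ * (1 + ‖y‖) := le_mul_of_one_le_right (by positivity) hy1
    nlinarith
  have k3 : ‖y‖ * (C₁ * ‖e‖) ≤ C₁ * (1 + ‖y‖) * ‖e‖ := by nlinarith [mul_nonneg hC₁0 he]
  have eC : (C₀ * C₁ + Cp + C₀ + C₁) * (1 + ‖y‖) * ‖e‖ = C₀ * C₁ * (1 + ‖y‖) * ‖e‖ +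
      Cp * (1 + ‖y‖) * ‖e‖ + C₀ * (1 + ‖y‖) * ‖e‖ + C₁ * (1 + ‖y‖) * ‖e‖ := by ring
  have hpos : 0 ≤ C₀ * (1 + ‖y‖) * ‖e‖ + C₁ * (1 + ‖y‖) * ‖e‖ := by positivity
  linarith

/-- **Quadratic growth of the error term**: `|E(y)| ≤ (C₀ + 1)(C₀ + C₁)(1 + |y|)²`
(from `|E| ≤ ‖U + ½y‖‖RU‖`). [cite: PineauVicol2026, Lemma 4.1 (4.5) (p. 12)] -/
theorem rotationDefect_abs_errorTerm_le_sq (hC₀ : 0 ≤ C₀) (hUb : ∀ y, ‖U y‖ ≤ C₀)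
    (hC₁ : ∀ y, ‖fderiv ℝ U y‖ ≤ C₁) (y : EuclideanSpace ℝ (Fin 3)) :
    |(1 / 2 : ℝ) * ⟪rotGen y, U y⟫ + ⟪U y + (1 / 2 : ℝ) • y, fderiv ℝ U y (rotGen y)⟫| ≤
      (C₀ + 1) * (C₀ + C₁) * (1 + ‖y‖) ^ 2 := by
  have hC₁0 : 0 ≤ C₁ := (norm_nonneg _).trans (hC₁ 0)
  have hy1 : (1 : ℝ) ≤ 1 + ‖y‖ := by linarith [norm_nonneg y]
  calc |(1 / 2 : ℝ) * ⟪rotGen y, U y⟫ + ⟪U y + (1 / 2 : ℝ) • y, fderiv ℝ U y (rotGen y)⟫|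
      ≤ ‖U y + (1 / 2 : ℝ) • y‖ * ‖rotGen (U y) - fderiv ℝ U y (rotGen y)‖ :=
        rotationDefect_abs_errorTerm_le U y
    _ ≤ (C₀ + 1) * (1 + ‖y‖) * ((C₀ + C₁) * (1 + ‖y‖)) :=
        mul_le_mul (rotationDefect_norm_drift_le hC₀ hUb y)
          (rotationDefect_norm_defect_le hC₀ hUb hC₁ y) (norm_nonneg _) (by positivity)
    _ = (C₀ + 1) * (C₀ + C₁) * (1 + ‖y‖) ^ 2 := by ring

/-- `|curl U|² ≤ (‖curlCLM‖ C₁)²` when `‖DU‖ ≤ C₁` (the curl is a fixed linear image of the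
gradient). [folklore] -/
theorem rotationDefect_norm_curl_sq_le (hC₁ : ∀ y, ‖fderiv ℝ U y‖ ≤ C₁)
    (y : EuclideanSpace ℝ (Fin 3)) : ‖curl U y‖ ^ 2 ≤ (‖curlCLM‖ * C₁) ^ 2 := by
  have h := (norm_curl_le U y).trans (mul_le_mul_of_nonneg_left (hC₁ y) (norm_nonneg curlCLM))
  exact pow_le_pow_left₀ (norm_nonneg _) h 2

end Bounds


/-! ### Registered form -/

/-- **Registered helper stub `rotationDefect_errorTermBound`** (explicit-binder form of
`rotationDefect_abs_errorTerm_le`): `|E| ≤ ‖U + ½y‖ ‖RU‖` pointwise, for every field `U` on `ℝ³`.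
[cite: PineauVicol2026, (4.3)–(4.4) (p. 11)] -/
theorem rotationDefect_errorTermBound :
    ∀ (U : EuclideanSpace ℝ (Fin 3) → EuclideanSpace ℝ (Fin 3)) (y : EuclideanSpace ℝ (Fin 3)), |(1 / 2 : ℝ) * inner ℝ (Literature.Analysis.FluidPDE.rotGen y) (U y) + inner ℝ (U y + (1 / 2 : ℝ) • y) (fderiv ℝ U y (Literature.Analysis.FluidPDE.rotGen y))| ≤ ‖U y + (1 / 2 : ℝ) • y‖ * ‖Literature.Analysis.FluidPDE.rotGen (U y) - fderiv ℝ U y (Literature.Analysis.FluidPDE.rotGen y)‖ :=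
  fun U y => rotationDefect_abs_errorTerm_le U y

end Summit.NavierStokesRegularity.NavierStokesRegularity.Theorems

end
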